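import Literature.MathematicalPhysics.QuantumLattice.InfVolFermionStateTorusLimitTwoSectorCompanionExistence
import Literature.MathematicalPhysics.QuantumLattice.InfVolFermionStateTorusLimitTwoSectorPairAnnihilator
import HarnessLib

/-!
# Companion data for the «add↑» and the PAIR templates of the thermal object of record exist,
# hypothesis-free; the rows between the two companions

Topic `Literature/MathematicalPhysics/QuantumLattice`; complement of
`InfVolFermionStateTorusLimitTwoSectorCompanionExistence.lean` (abstract existence theorem
`IsTorusLimitOfMixture.exists_twoSector_companion_of_pos_moments` and its «rm↑» instance) and of
`…TwoSectorSingleCreator.lean` / `…TwoSectorPairAnnihilator.lean` (the «add↑» and pair rows GIVEN joint data).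
For every torus limit `ω` of the canonical `(rectN n L, S^z = 0)` Gibbs states of `hubbardTorusTT' L t t' U`
along `Ls → ∞` with `0 < n < 2`:

* §2 `IsTorusLimitOfMixture.exists_twoSector_succCompanion_of_sectorGibbs` — the «add↑» joint data
  `(φ, ω', r > 0)` on the image sectors `(k_L + 1, k_L)` exist (the `x`-moment of `c†_{0↑}` in `ω` is the hole
  density `1 − n/2 > 0`, its `y'`-moment in any companion is the density `n/2 > 0`; the image sector is
  nonempty eventually since `n < 2`, `eventually_halfRectN_succ_le_mul_self`);
* §3 `IsTorusLimitOfMixture.exists_twoSector_pairCompanion_of_sectorGibbs` — by CHAINING two single steps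
  `(k, k) → (k − 1, k) → (k − 1, k − 1)` (the abstract theorem applied to `ω` with `c_{0↑}`, then to the
  companion `ω'` with `c_{0↓}`): joint data `(φ, ω', ω'', r₁ > 0, r₂ > 0)` with
  `Z_{(k−1,k)}/Z_{(k,k)} → r₁`, `Z_{(k−1,k−1)}/Z_{(k−1,k)} → r₂`, hence `Z_{(k−1,k−1)}/Z_{(k,k)} → r₁r₂` — the
  hypotheses of `…re_expect_twoSector_eeb_pairAnnihilation_nonneg_of_sectorGibbs` (with `r = r₁r₂ > 0`) and
  of both single-step row families (the pair generator's own `x`-moment `ω(n_{x↑}n_{y↓})` is a correlation,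
  not a density — the chain avoids needing its positivity);
* §4 the rows BETWEEN the two companions by name (`c_{x↓}` from `(k − 1, k)` to `(k − 1, k − 1)` and the
  reversed `c†_{x↓}` link): `…annihilation_down_nonneg_of_predCompanion`,
  `…creation_down_reverse_nonneg_of_pairCompanion`;
* §1 bookkeeping: `k_L + 1 ≤ L²` eventually, `(k_L + 1)/L² → n/2`, the spin densities of the companions
  `(k + 1, k)`, `(k − 1, k)` (down), `(k − 1, k − 1)` (all `= n/2`), and the sector lemmas for `c_{y↓}`, `c†_{y↓}`
  between `(k − 1, k)` and `(k − 1, k − 1)`.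

HONEST SCOPE: existence along a subsequence, rows for pairs of states; no uniqueness, no `ω' = ω`, no
number. Everything is PROVED; no definition, no named fact.

## Mathlib / tree search

REUSED: `IsTorusLimitOfMixture.exists_twoSector_companion_of_pos_moments`,
`…exists_twoSector_predCompanion_of_sectorGibbs` (`…CompanionExistence`); moment/density lemmas of
`…TwoSectorReverseRow`; `IsTorusLimitOfMixture.re_expect_nAt_eq_of_spinSectorGibbs` (`…SpinSectorDensity`);
`creation_up_mulVec_mem_szSector_succ`, `annihilation_up_mulVec_mem_szSector_rectN_of_succ`,
`fermionEmbed_toTorusEmb_incl_creation` (`…SingleCreator`); `IsInSector.annihilation_down_mulVec`,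
`IsInSector.creation_down_mulVec`, `mem_szSector_iff_isInSector` (`HubbardSzSectorLadder`);
`InfVolFermionState.re_expect_twoSector_eeb_nonneg_of_canonical_limits_eventually` (`…SingleAnnihilator`).
`lean search 'succCompanion|pairCompanion'`: nothing (2026-08-27).

## References

* O. Bratteli, D. W. Robinson, *Operator Algebras and Quantum Statistical Mechanics 1* (1987), Thm. 2.3.15,
  §4.3.1. [cite: BratteliRobinsonI1987, Thm. 2.3.15 (weak-⋆ compactness of the state space) and §4.3.1]
* O. Bratteli, D. W. Robinson, *Operator Algebras and Quantum Statistical Mechanics 2* (1997), §5.4.2.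
  [cite: BratteliRobinsonII1997, §5.4.2]
* H. Fawzi, O. Fawzi, S. O. Scalet (2024), Thm. 3.1. [cite: FawziFawziScalet2024, Thm. 3.1]
* E. H. Lieb, Phys. Rev. Lett. 62 (1989) 1201, eq. (2) and proof of Thm. 1. [cite: LiebPRL1989, proof of Theorem 1]
* D. Ruelle, *Statistical Mechanics: Rigorous Results* (1969), §3.4. [cite: Ruelle1969, §3.4]
* J. P. F. LeBlanc et al., Phys. Rev. X 5 (2015) 041041, eq. (1). [cite: LeBlancEtAl2015, eq. (1)]
-/

noncomputable section

namespace Literature.MathematicalPhysics.QuantumLattice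

open Matrix Finset HubbardWave0 Literature.Probability.LatticeModels ThermodynamicLimit
open _root_.Filter
open scoped _root_.Topology ComplexOrder BigOperators

/-! ### §1 Bookkeeping: the sectors `(k_L + 1, k_L)`, `(k_L − 1, k_L − 1)` and their densities -/

section Bookkeeping

/-- **`k_L + 1 ≤ L²` eventually** along `Ls → ∞` when `n < 2` (the «add↑» image sector is nonempty).
[cite: LeBlancEtAl2015, eq. (1)] -/
theorem eventually_halfRectN_succ_le_mul_self {n : ℝ} (hn0 : 0 ≤ n) (hn2 : n < 2) {Ls : ℕ → ℕ}
    (hLs : Tendsto Ls atTop atTop) : ∀ᶠ j in atTop, halfRectN n (Ls j) + 1 ≤ Ls j * Ls j := by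
  have hc : 0 < 1 - n / 2 := by linarith
  filter_upwards [hLs.eventually_ge_atTop (⌈1 / (1 - n / 2)⌉₊ + 1)] with j hj
  have hL1 : (1 : ℝ) ≤ Ls j := by exact_mod_cast (show 1 ≤ Ls j by omega)
  have hLc : 1 / (1 - n / 2) ≤ (Ls j : ℝ) := by
    have h1 : (⌈1 / (1 - n / 2)⌉₊ : ℝ) + 1 ≤ Ls j := by exact_mod_cast hj
    exact (Nat.le_ceil _).trans (by linarith)
  have hk := halfRectN_le_half_mul_sq hn0 (Ls j)
  have h1 : 1 ≤ (1 - n / 2) * (Ls j : ℝ) := by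
    rw [div_le_iff₀ hc] at hLc; linarith
  have h2 : (1 - n / 2) * (Ls j : ℝ) ≤ (1 - n / 2) * ((Ls j : ℝ) * Ls j) :=
    mul_le_mul_of_nonneg_left (le_mul_of_one_le_left (by positivity) hL1) hc.le
  have h3 : (halfRectN n (Ls j) : ℝ) + 1 ≤ (Ls j : ℝ) * Ls j := by rw [sq] at hk; nlinarith
  exact_mod_cast h3

/-- **`(k_{L_j} + 1)/L_j² → n/2`** along `Ls → ∞` (`0 ≤ n`). [cite: LeBlancEtAl2015, eq. (1)] -/
theorem tendsto_halfRectN_succ_div_sq_comp {n : ℝ} (hn0 : 0 ≤ n) {Ls : ℕ → ℕ} (hLs : Tendsto Ls atTop atTop) :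
    Tendsto (fun j => ((halfRectN n (Ls j) + 1 : ℕ) : ℝ) / (Ls j : ℝ) ^ 2) atTop (𝓝 (n / 2)) := by
  have hL : Tendsto (fun j => ((Ls j : ℕ) : ℝ)) atTop atTop := tendsto_natCast_atTop_atTop.comp hLs
  have hsq : Tendsto (fun j => ((Ls j : ℝ) ^ 2)⁻¹) atTop (𝓝 0) :=
    (tendsto_pow_atTop two_ne_zero |>.comp hL).inv_tendsto_atTop
  have h := (tendsto_halfRectN_div_sq_comp hn0 hLs).add hsq
  rw [add_zero] at h
  refine h.congr fun j => ?_
  push_cast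
  rw [add_div, inv_eq_one_div]

namespace InfVolFermionState

/-- **Up-spin density of the companion `(k_L + 1, k_L)`** (the image of `c†_{x↑}`): a torus limit along
`Ls → ∞` of its canonical eigen-mixtures (`0 ≤ n < 2`) has `Re ω'(n_{0↑}) = n/2`.
[cite: Ruelle1969, §3.4] [cite: LiebPRL1989, eq. (2)] -/
theorem IsTorusLimitOfMixture.re_expect_nAt_up_eq_half_of_succCompanion (t t' U β : ℝ) {n : ℝ}
    (hn0 : 0 ≤ n) (hn2 : n < 2) {Ls : ℕ → ℕ} (hLs : Tendsto Ls atTop atTop) {ω' : InfVolFermionState 2}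
    (hω' : ω'.IsTorusLimitOfMixture
      (fun L => Fintype.card (Subtype (spinConfig (Λ := FermionTorus 2 L) (halfRectN n L + 1) (halfRectN n L))))
      (fun L i => canonicalWeight β (sectorEigenvalue (spinConfig (halfRectN n L + 1) (halfRectN n L))
        (hubbardTorusTT' L t t' U) (hubbardTorusTT'_isHermitian L t t' U)) ((Fintype.equivFin _).symm i))
      (fun L i => sectorEigenvector (spinConfig (halfRectN n L + 1) (halfRectN n L)) (hubbardTorusTT' L t t' U)
        (hubbardTorusTT'_isHermitian L t t' U) ((Fintype.equivFin _).symm i)) Ls) :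
    (ω'.expect {0} (nAt 0 (Finset.mem_singleton_self 0) 0)).re = n / 2 :=
  (hω'.re_expect_nAt_eq_of_spinSectorGibbs t t' U β (fun L => halfRectN n L + 1) (fun L => halfRectN n L)
    (fun _ => (Fintype.equivFin _).symm) (fun _ _ => rfl) (fun _ _ => rfl) hLs
    ((eventually_halfRectN_succ_le_mul_self hn0 hn2 hLs).mono fun j hj =>
      ⟨hj, halfRectN_le_mul_self hn0 hn2.le (Ls j)⟩)).1
    (tendsto_halfRectN_succ_div_sq_comp hn0 hLs)

/-- **Down-spin density of the companion `(k_L − 1, k_L)`**: `Re ω'(n_{0↓}) = n/2` (`0 ≤ n ≤ 2`).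
[cite: Ruelle1969, §3.4] [cite: LiebPRL1989, eq. (2)] -/
theorem IsTorusLimitOfMixture.re_expect_nAt_down_eq_half_of_predCompanion (t t' U β : ℝ) {n : ℝ}
    (hn0 : 0 ≤ n) (hn2 : n ≤ 2) {Ls : ℕ → ℕ} (hLs : Tendsto Ls atTop atTop) {ω' : InfVolFermionState 2}
    (hω' : ω'.IsTorusLimitOfMixture
      (fun L => Fintype.card (Subtype (spinConfig (Λ := FermionTorus 2 L) (halfRectN n L - 1) (halfRectN n L))))
      (fun L i => canonicalWeight β (sectorEigenvalue (spinConfig (halfRectN n L - 1) (halfRectN n L))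
        (hubbardTorusTT' L t t' U) (hubbardTorusTT'_isHermitian L t t' U)) ((Fintype.equivFin _).symm i))
      (fun L i => sectorEigenvector (spinConfig (halfRectN n L - 1) (halfRectN n L)) (hubbardTorusTT' L t t' U)
        (hubbardTorusTT'_isHermitian L t t' U) ((Fintype.equivFin _).symm i)) Ls) :
    (ω'.expect {0} (nAt 0 (Finset.mem_singleton_self 0) 1)).re = n / 2 :=
  (hω'.re_expect_nAt_eq_of_spinSectorGibbs t t' U β (fun L => halfRectN n L - 1) (fun L => halfRectN n L)
    (fun _ => (Fintype.equivFin _).symm) (fun _ _ => rfl) (fun _ _ => rfl) hLs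
    (Eventually.of_forall fun j =>
      ⟨(Nat.sub_le _ _).trans (halfRectN_le_mul_self hn0 hn2 (Ls j)), halfRectN_le_mul_self hn0 hn2 (Ls j)⟩)).2
    (tendsto_halfRectN_div_sq_comp hn0 hLs)

/-- **Down-spin density of the PAIR companion `(k_L − 1, k_L − 1)`**: `Re ω''(n_{0↓}) = n/2` (`0 ≤ n ≤ 2`).
[cite: Ruelle1969, §3.4] [cite: LiebPRL1989, eq. (2)] -/
theorem IsTorusLimitOfMixture.re_expect_nAt_down_eq_half_of_pairCompanion (t t' U β : ℝ) {n : ℝ}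
    (hn0 : 0 ≤ n) (hn2 : n ≤ 2) {Ls : ℕ → ℕ} (hLs : Tendsto Ls atTop atTop) {ω'' : InfVolFermionState 2}
    (hω'' : ω''.IsTorusLimitOfMixture
      (fun L => Fintype.card (Subtype (spinConfig (Λ := FermionTorus 2 L) (halfRectN n L - 1) (halfRectN n L - 1))))
      (fun L i => canonicalWeight β (sectorEigenvalue (spinConfig (halfRectN n L - 1) (halfRectN n L - 1))
        (hubbardTorusTT' L t t' U) (hubbardTorusTT'_isHermitian L t t' U)) ((Fintype.equivFin _).symm i))
      (fun L i => sectorEigenvector (spinConfig (halfRectN n L - 1) (halfRectN n L - 1)) (hubbardTorusTT' L t t' U)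
        (hubbardTorusTT'_isHermitian L t t' U) ((Fintype.equivFin _).symm i)) Ls) :
    (ω''.expect {0} (nAt 0 (Finset.mem_singleton_self 0) 1)).re = n / 2 :=
  (hω''.re_expect_nAt_eq_of_spinSectorGibbs t t' U β (fun L => halfRectN n L - 1) (fun L => halfRectN n L - 1)
    (fun _ => (Fintype.equivFin _).symm) (fun _ _ => rfl) (fun _ _ => rfl) hLs
    (Eventually.of_forall fun j =>
      ⟨(Nat.sub_le _ _).trans (halfRectN_le_mul_self hn0 hn2 (Ls j)),
        (Nat.sub_le _ _).trans (halfRectN_le_mul_self hn0 hn2 (Ls j))⟩)).2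
    (tendsto_halfRectN_pred_div_sq_comp hn0 hLs)

end InfVolFermionState

/-- **`c_{y↓}` carries the companion sector `(k − 1, k)` into the pair sector `(k − 1, k − 1)`** (`k ≥ 1`).
[cite: LiebPRL1989, proof of Theorem 1] -/
theorem annihilation_down_mulVec_mem_szSector_pairPred (L : ℕ) {n : ℝ} (hk : 1 ≤ halfRectN n L)
    (y : FermionTorus 2 L) (w : Fock (Orb (FermionTorus 2 L)))
    (hw : w ∈ szSector ((halfRectN n L - 1) + halfRectN n L) ((((halfRectN n L - 1 : ℕ) : ℝ) - halfRectN n L) / 2)) :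
    annihilation (orb y 1) *ᵥ w ∈
      szSector ((halfRectN n L - 1) + (halfRectN n L - 1))
        ((((halfRectN n L - 1 : ℕ) : ℝ) - ((halfRectN n L - 1 : ℕ) : ℝ)) / 2) := by
  rw [mem_szSector_iff_isInSector]
  have hw' : IsInSector (halfRectN n L - 1) (halfRectN n L - 1 + 1) w := by
    rw [Nat.sub_add_cancel hk]
    exact (mem_szSector_iff_isInSector _ _ w).1 hw
  exact hw'.annihilation_down_mulVec y

/-- **`c†_{y↓}` carries the pair sector `(k − 1, k − 1)` back into `(k − 1, k)`** (`k ≥ 1`).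
[cite: LiebPRL1989, proof of Theorem 1] -/
theorem creation_down_mulVec_mem_szSector_pred_of_pairPred (L : ℕ) {n : ℝ} (hk : 1 ≤ halfRectN n L)
    (y : FermionTorus 2 L) (w : Fock (Orb (FermionTorus 2 L)))
    (hw : w ∈ szSector ((halfRectN n L - 1) + (halfRectN n L - 1))
        ((((halfRectN n L - 1 : ℕ) : ℝ) - ((halfRectN n L - 1 : ℕ) : ℝ)) / 2)) :
    (annihilation (orb y 1))ᴴ *ᵥ w ∈
      szSector ((halfRectN n L - 1) + halfRectN n L) ((((halfRectN n L - 1 : ℕ) : ℝ) - halfRectN n L) / 2) := by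
  rw [annihilation_conjTranspose, mem_szSector_iff_isInSector]
  have hw' : IsInSector (halfRectN n L - 1) (halfRectN n L - 1) w := (mem_szSector_iff_isInSector _ _ w).1 hw
  have h := hw'.creation_down_mulVec y
  rw [Nat.sub_add_cancel hk] at h
  exact h

end Bookkeeping

/-! ### §2 The «add↑» companion of the thermal object of record: image sectors `(k_L + 1, k_L)` -/

section Succ

variable (t t' U β : ℝ)

/-- **The joint data of the «add↑» rows exist, hypothesis-free.** For every torus limit `ω` of the canonical
`(rectN n L, S^z = 0)` Gibbs states of `hubbardTorusTT' L t t' U` at inverse temperature `β` along `Ls → ∞`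
(`0 < n < 2`) there are a strictly increasing `φ`, a state `ω'` and `r > 0` such that `ω` is the torus limit
of the object of record along `Ls ∘ φ`, `ω'` is the torus limit along `Ls ∘ φ` of the canonical eigen-mixtures
of the image sectors `(k_L + 1, k_L)` of `c†_{x↑}`, and `Z_{(k+1,k)}(Ls (φ j))/Z_{(k,k)}(Ls (φ j)) → r` — the
hypotheses of `IsTorusLimitOfMixture.re_expect_twoSector_eeb_creation_up_nonneg_of_sectorGibbs`. (The
`x`-moment of `c†_{0↑}` in `ω` is the hole density `1 − n/2 > 0`; its `y'`-moment in any companion is the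
density `n/2 > 0`.) [cite: BratteliRobinsonI1987, Thm. 2.3.15 (weak-⋆ compactness of the state space) and §4.3.1]
[cite: BratteliRobinsonII1997, §5.4.2] [cite: FawziFawziScalet2024, Thm. 3.1] -/
theorem InfVolFermionState.IsTorusLimitOfMixture.exists_twoSector_succCompanion_of_sectorGibbs
    {n : ℝ} (hn0 : 0 < n) (hn2 : n < 2) {Ls : ℕ → ℕ} (hLs : Tendsto Ls atTop atTop)
    {ω : InfVolFermionState 2}
    (hω : ω.IsTorusLimitOfMixture (sectorGibbsCount n) (fun L => sectorGibbsWeightTT' β t t' U n L)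
      (fun L => sectorGibbsVectorTT' t t' U n L) Ls) :
    ∃ φ : ℕ → ℕ, StrictMono φ ∧ ∃ ω' : InfVolFermionState 2, ∃ r : ℝ, 0 < r ∧
      ω.IsTorusLimitOfMixture (sectorGibbsCount n) (fun L => sectorGibbsWeightTT' β t t' U n L)
        (fun L => sectorGibbsVectorTT' t t' U n L) (Ls ∘ φ) ∧
      ω'.IsTorusLimitOfMixture
        (fun L => Fintype.card (Subtype (spinConfig (Λ := FermionTorus 2 L) (halfRectN n L + 1) (halfRectN n L))))
        (fun L i => canonicalWeight β (sectorEigenvalue (spinConfig (halfRectN n L + 1) (halfRectN n L))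
          (hubbardTorusTT' L t t' U) (hubbardTorusTT'_isHermitian L t t' U)) ((Fintype.equivFin _).symm i))
        (fun L i => sectorEigenvector (spinConfig (halfRectN n L + 1) (halfRectN n L)) (hubbardTorusTT' L t t' U)
          (hubbardTorusTT'_isHermitian L t t' U) ((Fintype.equivFin _).symm i)) (Ls ∘ φ) ∧
      Tendsto (fun j =>
        (∑ d, Real.exp (-(β * sectorEigenvalue (spinConfig (halfRectN n (Ls (φ j)) + 1) (halfRectN n (Ls (φ j))))
            (hubbardTorusTT' (Ls (φ j)) t t' U) (hubbardTorusTT'_isHermitian (Ls (φ j)) t t' U) d))) /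
          (∑ c, Real.exp (-(β * sectorEigenvalue (szConfig n (Ls (φ j))) (hubbardTorusTT' (Ls (φ j)) t t' U)
            (hubbardTorusTT'_isHermitian (Ls (φ j)) t t' U) c)))) atTop (𝓝 r) := by
  have hn0' : 0 ≤ n := hn0.le
  have hn2' : n ≤ 2 := hn2.le
  refine hω.exists_twoSector_companion_of_pos_moments t t' U β
    (fun L => szConfig n L) (fun L => spinConfig (Λ := FermionTorus 2 L) (halfRectN n L + 1) (halfRectN n L))
    (fun L s s' hs hs' => hubbardTorusTT'_apply_eq_zero_of_szConfig L t t' U n s s' hs hs')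
    (fun L s s' hs hs' => hubbardTorusTT'_apply_eq_zero_of_spinConfig L t t' U _ _ s s' hs hs')
    (fun L _ v s s' hs hs' => fockTranslate_apply_eq_zero_of_szConfig L v n s s' hs hs')
    (fun L _ v s s' hs hs' => fockTranslate_apply_eq_zero_of_spinConfig L v _ _ s s' hs hs')
    (fun L => sectorGibbsIndex n L) (fun L => (Fintype.equivFin _).symm)
    (sectorGibbsWeightTT'_eq_canonicalWeight t t' U β n) (fun L i => rfl) (fun L i => rfl) (fun L i => rfl) hLs
    (Eventually.of_forall fun j => ?_) ?_
    (Λ := {0}) (creation (orb (PolySite.pt (0 : Site 2) (Finset.mem_singleton_self 0)) 0)) ?_ ?_ ?_ ?_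
  · obtain ⟨s, hs⟩ := exists_szConfig hn0' hn2' (Ls j)
    exact ⟨⟨s, hs⟩⟩
  · filter_upwards [eventually_halfRectN_succ_le_mul_self hn0' hn2 hLs] with j hj
    obtain ⟨s, hs⟩ := exists_spinConfig_of_le (Ls j) hj (halfRectN_le_mul_self hn0' hn2' (Ls j))
    exact ⟨⟨s, hs⟩⟩
  · filter_upwards with j hL h₁ s s' hs hs'
    rw [fermionEmbed_toTorusEmb_incl_creation]
    exact apply_eq_zero_off_of_mulVec_mem₂ (szConfig n (Ls j)) (spinConfig _ _)
      (szSector (rectN n (Ls j)) 0) (szSector _ _) (mem_szSector_rectN_iff n (Ls j))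
      (mem_szSector_iff_spinConfig (Ls j) _ _)
      (fun w hw => creation_up_mulVec_mem_szSector_succ (Ls j) _ w hw) s s' hs hs'
  · filter_upwards with j hL h₁ s s' hs hs'
    rw [fermionEmbed_toTorusEmb_incl_creation]
    exact apply_eq_zero_off_of_mulVec_mem₂ (spinConfig _ _) (szConfig n (Ls j))
      (szSector _ _) (szSector (rectN n (Ls j)) 0) (mem_szSector_iff_spinConfig (Ls j) _ _)
      (mem_szSector_rectN_iff n (Ls j))
      (fun w hw => annihilation_up_mulVec_mem_szSector_rectN_of_succ (Ls j) _ w hw) s s' hs hs'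
  · rw [← annihilation_conjTranspose, fermionEmbed_conjTranspose, conjTranspose_conjTranspose,
      hω.isTranslationInvariant.expect_fermionEmbed_incl_cAt_mul_conjTranspose, Complex.sub_re, Complex.one_re,
      hω.re_expect_nAt_eq_half_of_sectorGibbs t t' U β hn0' hn2' hLs 0]
    linarith
  · intro φ ω' hφ hω'
    rw [← annihilation_conjTranspose, fermionEmbed_conjTranspose, conjTranspose_conjTranspose,
      hω'.isTranslationInvariant.expect_conjTranspose_mul_fermionEmbed_incl_cAt,
      hω'.re_expect_nAt_up_eq_half_of_succCompanion t t' U β hn0' hn2 (hLs.comp hφ.tendsto_atTop)]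
    exact half_pos hn0

end Succ

/-! ### §3 The PAIR companion by chaining two single steps: `(k, k) → (k − 1, k) → (k − 1, k − 1)` -/

section Pair

variable (t t' U β : ℝ)

/-- **The joint data of the «rm↑», the «rm↓ from the companion» and the PAIR rows exist simultaneously,
hypothesis-free.** For every torus limit `ω` of the canonical `(rectN n L, S^z = 0)` Gibbs states along
`Ls → ∞` (`0 < n < 2`) there are a strictly increasing `φ`, states `ω'` (torus limit along `Ls ∘ φ` of the
canonical eigen-mixtures of `(k_L − 1, k_L)`) and `ω''` (the same for the PAIR sectors `(k_L − 1, k_L − 1)`,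
`S^z = 0` again) and reals `r₁, r₂ > 0` with `Z_{(k−1,k)}/Z_{(k,k)} → r₁`, `Z_{(k−1,k−1)}/Z_{(k−1,k)} → r₂`
and hence `Z_{(k−1,k−1)}/Z_{(k,k)} → r₁r₂` along `Ls ∘ φ` — the joint data consumed by
`…re_expect_twoSector_eeb_annihilation_up_nonneg_of_sectorGibbs` (`ω, ω', r₁`), by the general pair theorem
between the two companions (`ω', ω'', r₂`; generator `c_{x↓}`), and by
`…re_expect_twoSector_eeb_pairAnnihilation_nonneg_of_sectorGibbs` (`ω, ω'', r₁r₂`). Chaining: the abstract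
existence theorem applied to `ω` with `c_{0↑}`, then to the companion `ω'` with `c_{0↓}` (its `x`-moment is
`ω'(n_{0↓}) = n/2 > 0`, the `y'`-moment of any pair companion is `1 − n/2 > 0`).
[cite: BratteliRobinsonI1987, Thm. 2.3.15 (weak-⋆ compactness of the state space) and §4.3.1]
[cite: BratteliRobinsonII1997, §5.4.2] [cite: FawziFawziScalet2024, Thm. 3.1] -/
theorem InfVolFermionState.IsTorusLimitOfMixture.exists_twoSector_pairCompanion_of_sectorGibbs
    {n : ℝ} (hn0 : 0 < n) (hn2 : n < 2) {Ls : ℕ → ℕ} (hLs : Tendsto Ls atTop atTop)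
    {ω : InfVolFermionState 2}
    (hω : ω.IsTorusLimitOfMixture (sectorGibbsCount n) (fun L => sectorGibbsWeightTT' β t t' U n L)
      (fun L => sectorGibbsVectorTT' t t' U n L) Ls) :
    ∃ φ : ℕ → ℕ, StrictMono φ ∧ ∃ ω' ω'' : InfVolFermionState 2, ∃ r₁ r₂ : ℝ, 0 < r₁ ∧ 0 < r₂ ∧
      ω.IsTorusLimitOfMixture (sectorGibbsCount n) (fun L => sectorGibbsWeightTT' β t t' U n L)
        (fun L => sectorGibbsVectorTT' t t' U n L) (Ls ∘ φ) ∧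
      ω'.IsTorusLimitOfMixture
        (fun L => Fintype.card (Subtype (spinConfig (Λ := FermionTorus 2 L) (halfRectN n L - 1) (halfRectN n L))))
        (fun L i => canonicalWeight β (sectorEigenvalue (spinConfig (halfRectN n L - 1) (halfRectN n L))
          (hubbardTorusTT' L t t' U) (hubbardTorusTT'_isHermitian L t t' U)) ((Fintype.equivFin _).symm i))
        (fun L i => sectorEigenvector (spinConfig (halfRectN n L - 1) (halfRectN n L)) (hubbardTorusTT' L t t' U)
          (hubbardTorusTT'_isHermitian L t t' U) ((Fintype.equivFin _).symm i)) (Ls ∘ φ) ∧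
      ω''.IsTorusLimitOfMixture
        (fun L => Fintype.card (Subtype (spinConfig (Λ := FermionTorus 2 L) (halfRectN n L - 1) (halfRectN n L - 1))))
        (fun L i => canonicalWeight β (sectorEigenvalue (spinConfig (halfRectN n L - 1) (halfRectN n L - 1))
          (hubbardTorusTT' L t t' U) (hubbardTorusTT'_isHermitian L t t' U)) ((Fintype.equivFin _).symm i))
        (fun L i => sectorEigenvector (spinConfig (halfRectN n L - 1) (halfRectN n L - 1)) (hubbardTorusTT' L t t' U)
          (hubbardTorusTT'_isHermitian L t t' U) ((Fintype.equivFin _).symm i)) (Ls ∘ φ) ∧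
      Tendsto (fun j =>
        (∑ d, Real.exp (-(β * sectorEigenvalue (spinConfig (halfRectN n (Ls (φ j)) - 1) (halfRectN n (Ls (φ j))))
            (hubbardTorusTT' (Ls (φ j)) t t' U) (hubbardTorusTT'_isHermitian (Ls (φ j)) t t' U) d))) /
          (∑ c, Real.exp (-(β * sectorEigenvalue (szConfig n (Ls (φ j))) (hubbardTorusTT' (Ls (φ j)) t t' U)
            (hubbardTorusTT'_isHermitian (Ls (φ j)) t t' U) c)))) atTop (𝓝 r₁) ∧
      Tendsto (fun j =>
        (∑ d, Real.exp (-(β * sectorEigenvalue (spinConfig (halfRectN n (Ls (φ j)) - 1) (halfRectN n (Ls (φ j)) - 1))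
            (hubbardTorusTT' (Ls (φ j)) t t' U) (hubbardTorusTT'_isHermitian (Ls (φ j)) t t' U) d))) /
          (∑ c, Real.exp (-(β * sectorEigenvalue (spinConfig (halfRectN n (Ls (φ j)) - 1) (halfRectN n (Ls (φ j))))
            (hubbardTorusTT' (Ls (φ j)) t t' U) (hubbardTorusTT'_isHermitian (Ls (φ j)) t t' U) c)))) atTop (𝓝 r₂) ∧
      Tendsto (fun j =>
        (∑ d, Real.exp (-(β * sectorEigenvalue (spinConfig (halfRectN n (Ls (φ j)) - 1) (halfRectN n (Ls (φ j)) - 1))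
            (hubbardTorusTT' (Ls (φ j)) t t' U) (hubbardTorusTT'_isHermitian (Ls (φ j)) t t' U) d))) /
          (∑ c, Real.exp (-(β * sectorEigenvalue (szConfig n (Ls (φ j))) (hubbardTorusTT' (Ls (φ j)) t t' U)
            (hubbardTorusTT'_isHermitian (Ls (φ j)) t t' U) c)))) atTop (𝓝 (r₁ * r₂)) := by
  have hn0' : 0 ≤ n := hn0.le
  have hn2' : n ≤ 2 := hn2.le
  -- first step: the «rm↑» companion
  obtain ⟨φ₁, hφ₁, ω', r₁, hr₁0, hω₁, hω', hr₁⟩ :=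
    hω.exists_twoSector_predCompanion_of_sectorGibbs t t' U β hn0 hn2 hLs
  have hLs₁ : Tendsto (Ls ∘ φ₁) atTop atTop := hLs.comp hφ₁.tendsto_atTop
  -- second step: from the companion, lower one ↓-electron
  obtain ⟨φ₂, hφ₂, ω'', r₂, hr₂0, hω'₂, hω'', hr₂⟩ :=
    hω'.exists_twoSector_companion_of_pos_moments t t' U β
      (fun L => spinConfig (Λ := FermionTorus 2 L) (halfRectN n L - 1) (halfRectN n L))
      (fun L => spinConfig (Λ := FermionTorus 2 L) (halfRectN n L - 1) (halfRectN n L - 1))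
      (fun L s s' hs hs' => hubbardTorusTT'_apply_eq_zero_of_spinConfig L t t' U _ _ s s' hs hs')
      (fun L s s' hs hs' => hubbardTorusTT'_apply_eq_zero_of_spinConfig L t t' U _ _ s s' hs hs')
      (fun L _ v s s' hs hs' => fockTranslate_apply_eq_zero_of_spinConfig L v _ _ s s' hs hs')
      (fun L _ v s s' hs hs' => fockTranslate_apply_eq_zero_of_spinConfig L v _ _ s s' hs hs')
      (fun L => (Fintype.equivFin _).symm) (fun L => (Fintype.equivFin _).symm)
      (fun L i => rfl) (fun L i => rfl) (fun L i => rfl) (fun L i => rfl) hLs₁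
      (Eventually.of_forall fun j => by
        obtain ⟨s, hs⟩ := exists_spinConfig_of_le (Ls (φ₁ j))
          ((Nat.sub_le _ _).trans (halfRectN_le_mul_self hn0' hn2' _)) (halfRectN_le_mul_self hn0' hn2' _)
        exact ⟨⟨s, hs⟩⟩)
      (Eventually.of_forall fun j => by
        obtain ⟨s, hs⟩ := exists_spinConfig_of_le (Ls (φ₁ j))
          ((Nat.sub_le _ _).trans (halfRectN_le_mul_self hn0' hn2' _))
          ((Nat.sub_le _ _).trans (halfRectN_le_mul_self hn0' hn2' _))
        exact ⟨⟨s, hs⟩⟩)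
      (Λ := {0}) (annihilation (orb (PolySite.pt (0 : Site 2) (Finset.mem_singleton_self 0)) 1))
      (by
        filter_upwards [eventually_one_le_halfRectN_comp hn0 hLs₁] with j hk hL h₁ s s' hs hs'
        rw [fermionEmbed_toTorusEmb_incl_annihilation]
        exact apply_eq_zero_off_of_mulVec_mem₂ (spinConfig _ _) (spinConfig _ _) (szSector _ _) (szSector _ _)
          (mem_szSector_iff_spinConfig _ _ _) (mem_szSector_iff_spinConfig _ _ _)
          (fun w hw => annihilation_down_mulVec_mem_szSector_pairPred _ hk _ w hw) s s' hs hs')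
      (by
        filter_upwards [eventually_one_le_halfRectN_comp hn0 hLs₁] with j hk hL h₁ s s' hs hs'
        rw [fermionEmbed_toTorusEmb_incl_annihilation]
        exact apply_eq_zero_off_of_mulVec_mem₂ (spinConfig _ _) (spinConfig _ _) (szSector _ _) (szSector _ _)
          (mem_szSector_iff_spinConfig _ _ _) (mem_szSector_iff_spinConfig _ _ _)
          (fun w hw => creation_down_mulVec_mem_szSector_pred_of_pairPred _ hk _ w hw) s s' hs hs')
      (by
        rw [hω'.isTranslationInvariant.expect_conjTranspose_mul_fermionEmbed_incl_cAt,
          hω'.re_expect_nAt_down_eq_half_of_predCompanion t t' U β hn0' hn2' hLs₁]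
        exact half_pos hn0)
      (by
        intro φ ω'' hφ hω''
        rw [hω''.isTranslationInvariant.expect_fermionEmbed_incl_cAt_mul_conjTranspose, Complex.sub_re,
          Complex.one_re, hω''.re_expect_nAt_down_eq_half_of_pairCompanion t t' U β hn0' hn2' (hLs₁.comp hφ.tendsto_atTop)]
        linarith)
  -- assemble along `φ₁ ∘ φ₂`
  have hr₁' := hr₁.comp hφ₂.tendsto_atTop
  refine ⟨fun j => φ₁ (φ₂ j), hφ₁.comp hφ₂, ω', ω'', r₁, r₂, hr₁0, hr₂0,
    hω₁.comp_tendsto hφ₂.tendsto_atTop, hω'₂, hω'', hr₁', hr₂, ?_⟩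
  refine (hr₁'.mul hr₂).congr fun j => ?_
  have hZ : (∑ c, Real.exp (-(β * sectorEigenvalue
      (spinConfig (halfRectN n (Ls (φ₁ (φ₂ j))) - 1) (halfRectN n (Ls (φ₁ (φ₂ j)))))
      (hubbardTorusTT' (Ls (φ₁ (φ₂ j))) t t' U) (hubbardTorusTT'_isHermitian (Ls (φ₁ (φ₂ j))) t t' U) c))) ≠ 0 := by
    obtain ⟨s, hs⟩ := exists_spinConfig_of_le (Ls (φ₁ (φ₂ j)))
      ((Nat.sub_le _ _).trans (halfRectN_le_mul_self hn0' hn2' _)) (halfRectN_le_mul_self hn0' hn2' _)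
    haveI : Nonempty (Subtype (spinConfig (Λ := FermionTorus 2 (Ls (φ₁ (φ₂ j))))
      (halfRectN n (Ls (φ₁ (φ₂ j))) - 1) (halfRectN n (Ls (φ₁ (φ₂ j)))))) := ⟨⟨s, hs⟩⟩
    exact (Finset.sum_pos (fun _ _ => Real.exp_pos _) Finset.univ_nonempty).ne'
  have key : ∀ a b c : ℝ, b ≠ 0 → b / c * (a / b) = a / c := fun a b c hb => by
    rw [div_mul_div_comm, mul_comm b a, mul_div_mul_right _ _ hb]
  simp only [Function.comp_apply]
  exact key _ _ _ hZ

end Pair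

/-! ### §4 The «rm↓» rows BETWEEN the two companions: `c_{x↓}` from `(k − 1, k)` to `(k − 1, k − 1)` -/

section Between

variable (t t' U β : ℝ)

/-- **The two-sector row linking the «rm↑» companion to the pair companion.** Let `ω'` be a torus limit along
`Ls → ∞` of the canonical eigen-mixtures of the sectors `(k_L − 1, k_L)` and `ω''` one of the pair sectors
`(k_L − 1, k_L − 1)` along the same `Ls` (`0 < n`), and `r₂ = lim Z_{(k−1,k−1)}/Z_{(k−1,k)}`. Then for `x ∈ Λ`,
`c̃ = Γ_{Λ⊆Λ₁}c_{x↓}` and all `e^{s−1} ≤ q`: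
`0 ≤ β·Re ω'_{Λ₁}(c̃†(H_{Λ₁}c̃ − c̃H_{Λ₁})) − s·Re ω'_{Λ₁}(c̃†c̃) + q·r₂·Re ω''_{Λ₁}(c̃c̃†)` — with the data of
`…exists_twoSector_pairCompanion_of_sectorGibbs` this is the second link of the chain
`y ↔ y⁻ ↔ y^{pair}` of a canonical-native thermal relaxation. [cite: FawziFawziScalet2024, Thm. 3.1]
[cite: BratteliRobinsonII1997, §5.4.2] [cite: LiebPRL1989, proof of Theorem 1] -/
theorem InfVolFermionState.IsTorusLimitOfMixture.re_expect_twoSector_eeb_annihilation_down_nonneg_of_predCompanion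
    {n : ℝ} (hn : 0 < n) {Ls : ℕ → ℕ} (hLs : Tendsto Ls atTop atTop) {ω' ω'' : InfVolFermionState 2}
    (hω' : ω'.IsTorusLimitOfMixture
      (fun L => Fintype.card (Subtype (spinConfig (Λ := FermionTorus 2 L) (halfRectN n L - 1) (halfRectN n L))))
      (fun L i => canonicalWeight β (sectorEigenvalue (spinConfig (halfRectN n L - 1) (halfRectN n L))
        (hubbardTorusTT' L t t' U) (hubbardTorusTT'_isHermitian L t t' U)) ((Fintype.equivFin _).symm i))
      (fun L i => sectorEigenvector (spinConfig (halfRectN n L - 1) (halfRectN n L)) (hubbardTorusTT' L t t' U)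
        (hubbardTorusTT'_isHermitian L t t' U) ((Fintype.equivFin _).symm i)) Ls)
    (hω'' : ω''.IsTorusLimitOfMixture
      (fun L => Fintype.card (Subtype (spinConfig (Λ := FermionTorus 2 L) (halfRectN n L - 1) (halfRectN n L - 1))))
      (fun L i => canonicalWeight β (sectorEigenvalue (spinConfig (halfRectN n L - 1) (halfRectN n L - 1))
        (hubbardTorusTT' L t t' U) (hubbardTorusTT'_isHermitian L t t' U)) ((Fintype.equivFin _).symm i))
      (fun L i => sectorEigenvector (spinConfig (halfRectN n L - 1) (halfRectN n L - 1)) (hubbardTorusTT' L t t' U)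
        (hubbardTorusTT'_isHermitian L t t' U) ((Fintype.equivFin _).symm i)) Ls)
    {r₂ : ℝ} (hr₂ : Tendsto (fun j =>
      (∑ d, Real.exp (-(β * sectorEigenvalue (spinConfig (halfRectN n (Ls j) - 1) (halfRectN n (Ls j) - 1))
          (hubbardTorusTT' (Ls j) t t' U) (hubbardTorusTT'_isHermitian (Ls j) t t' U) d))) /
        ∑ c, Real.exp (-(β * sectorEigenvalue (spinConfig (halfRectN n (Ls j) - 1) (halfRectN n (Ls j)))
          (hubbardTorusTT' (Ls j) t t' U) (hubbardTorusTT'_isHermitian (Ls j) t t' U) c))) atTop (𝓝 r₂))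
    {Λ : Finset (Site 2)} {x : Site 2} (hx : x ∈ Λ) {s q : ℝ} (hq : Real.exp (s - 1) ≤ q) :
    0 ≤ β * (ω'.expect (thicken Λ 1)
          ((fermionEmbed (PolySite.incl (subset_thicken Λ 1)) (annihilation (orb (PolySite.pt x hx) 1)))ᴴ *
            ((hubbardTTPrimeFermionInteraction t t' U).localHamiltonian (thicken Λ 1) *
                fermionEmbed (PolySite.incl (subset_thicken Λ 1)) (annihilation (orb (PolySite.pt x hx) 1)) -
              fermionEmbed (PolySite.incl (subset_thicken Λ 1)) (annihilation (orb (PolySite.pt x hx) 1)) *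
                (hubbardTTPrimeFermionInteraction t t' U).localHamiltonian (thicken Λ 1)))).re -
        s * (ω'.expect (thicken Λ 1)
          ((fermionEmbed (PolySite.incl (subset_thicken Λ 1)) (annihilation (orb (PolySite.pt x hx) 1)))ᴴ *
            fermionEmbed (PolySite.incl (subset_thicken Λ 1)) (annihilation (orb (PolySite.pt x hx) 1)))).re +
        q * r₂ * (ω''.expect (thicken Λ 1)
          (fermionEmbed (PolySite.incl (subset_thicken Λ 1)) (annihilation (orb (PolySite.pt x hx) 1)) *
            (fermionEmbed (PolySite.incl (subset_thicken Λ 1)) (annihilation (orb (PolySite.pt x hx) 1)))ᴴ)).re := by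
  refine InfVolFermionState.re_expect_twoSector_eeb_nonneg_of_canonical_limits_eventually t t' U β
    (fun L => spinConfig (Λ := FermionTorus 2 L) (halfRectN n L - 1) (halfRectN n L))
    (fun L => spinConfig (Λ := FermionTorus 2 L) (halfRectN n L - 1) (halfRectN n L - 1))
    (fun L s s' hs hs' => hubbardTorusTT'_apply_eq_zero_of_spinConfig L t t' U _ _ s s' hs hs')
    (fun L s s' hs hs' => hubbardTorusTT'_apply_eq_zero_of_spinConfig L t t' U _ _ s s' hs hs')
    (fun L _ v s s' hs hs' => fockTranslate_apply_eq_zero_of_spinConfig L v _ _ s s' hs hs')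
    (fun L _ v s s' hs hs' => fockTranslate_apply_eq_zero_of_spinConfig L v _ _ s s' hs hs')
    (fun L => (Fintype.equivFin _).symm) (fun L => (Fintype.equivFin _).symm)
    (fun L i => rfl) (fun L i => rfl) (fun L i => rfl) (fun L i => rfl) hLs hω' hω'' hr₂
    (annihilation (orb (PolySite.pt x hx) 1)) ?_ ?_ hq
  · filter_upwards [eventually_one_le_halfRectN_comp hn hLs] with j hk hL h₁ s s' hs hs'
    rw [fermionEmbed_toTorusEmb_incl_annihilation]
    exact apply_eq_zero_off_of_mulVec_mem₂ (spinConfig _ _) (spinConfig _ _) (szSector _ _) (szSector _ _)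
      (mem_szSector_iff_spinConfig _ _ _) (mem_szSector_iff_spinConfig _ _ _)
      (fun w hw => annihilation_down_mulVec_mem_szSector_pairPred _ hk _ w hw) s s' hs hs'
  · filter_upwards [eventually_one_le_halfRectN_comp hn hLs] with j hk hL h₁ s s' hs hs'
    rw [fermionEmbed_toTorusEmb_incl_annihilation]
    exact apply_eq_zero_off_of_mulVec_mem₂ (spinConfig _ _) (spinConfig _ _) (szSector _ _) (szSector _ _)
      (mem_szSector_iff_spinConfig _ _ _) (mem_szSector_iff_spinConfig _ _ _)
      (fun w hw => creation_down_mulVec_mem_szSector_pred_of_pairPred _ hk _ w hw) s s' hs hs'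

/-- **The reversed link**: the raising generator `c†_{x↓}` from the pair companion `(k − 1, k − 1)` back to
`(k − 1, k)`, with the INVERTED ratio `r₂' = lim Z_{(k−1,k)}/Z_{(k−1,k−1)}`:
`0 ≤ β·Re ω''_{Λ₁}(c̃(H_{Λ₁}c̃† − c̃†H_{Λ₁})) − s·Re ω''_{Λ₁}(c̃c̃†) + q·r₂'·Re ω'_{Λ₁}(c̃†c̃)` (`c̃ = Γc_{x↓}`).
[cite: FawziFawziScalet2024, Thm. 3.1] [cite: BratteliRobinsonII1997, §5.4.2]
[cite: LiebPRL1989, proof of Theorem 1] -/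
theorem InfVolFermionState.IsTorusLimitOfMixture.re_expect_twoSector_eeb_creation_down_reverse_nonneg_of_pairCompanion
    {n : ℝ} (hn : 0 < n) {Ls : ℕ → ℕ} (hLs : Tendsto Ls atTop atTop) {ω' ω'' : InfVolFermionState 2}
    (hω' : ω'.IsTorusLimitOfMixture
      (fun L => Fintype.card (Subtype (spinConfig (Λ := FermionTorus 2 L) (halfRectN n L - 1) (halfRectN n L))))
      (fun L i => canonicalWeight β (sectorEigenvalue (spinConfig (halfRectN n L - 1) (halfRectN n L))
        (hubbardTorusTT' L t t' U) (hubbardTorusTT'_isHermitian L t t' U)) ((Fintype.equivFin _).symm i))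
      (fun L i => sectorEigenvector (spinConfig (halfRectN n L - 1) (halfRectN n L)) (hubbardTorusTT' L t t' U)
        (hubbardTorusTT'_isHermitian L t t' U) ((Fintype.equivFin _).symm i)) Ls)
    (hω'' : ω''.IsTorusLimitOfMixture
      (fun L => Fintype.card (Subtype (spinConfig (Λ := FermionTorus 2 L) (halfRectN n L - 1) (halfRectN n L - 1))))
      (fun L i => canonicalWeight β (sectorEigenvalue (spinConfig (halfRectN n L - 1) (halfRectN n L - 1))
        (hubbardTorusTT' L t t' U) (hubbardTorusTT'_isHermitian L t t' U)) ((Fintype.equivFin _).symm i))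
      (fun L i => sectorEigenvector (spinConfig (halfRectN n L - 1) (halfRectN n L - 1)) (hubbardTorusTT' L t t' U)
        (hubbardTorusTT'_isHermitian L t t' U) ((Fintype.equivFin _).symm i)) Ls)
    {r₂' : ℝ} (hr₂' : Tendsto (fun j =>
      (∑ c, Real.exp (-(β * sectorEigenvalue (spinConfig (halfRectN n (Ls j) - 1) (halfRectN n (Ls j)))
          (hubbardTorusTT' (Ls j) t t' U) (hubbardTorusTT'_isHermitian (Ls j) t t' U) c))) /
        ∑ d, Real.exp (-(β * sectorEigenvalue (spinConfig (halfRectN n (Ls j) - 1) (halfRectN n (Ls j) - 1))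
          (hubbardTorusTT' (Ls j) t t' U) (hubbardTorusTT'_isHermitian (Ls j) t t' U) d))) atTop (𝓝 r₂'))
    {Λ : Finset (Site 2)} {x : Site 2} (hx : x ∈ Λ) {s q : ℝ} (hq : Real.exp (s - 1) ≤ q) :
    0 ≤ β * (ω''.expect (thicken Λ 1)
          ((fermionEmbed (PolySite.incl (subset_thicken Λ 1)) (creation (orb (PolySite.pt x hx) 1)))ᴴ *
            ((hubbardTTPrimeFermionInteraction t t' U).localHamiltonian (thicken Λ 1) *
                fermionEmbed (PolySite.incl (subset_thicken Λ 1)) (creation (orb (PolySite.pt x hx) 1)) -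
              fermionEmbed (PolySite.incl (subset_thicken Λ 1)) (creation (orb (PolySite.pt x hx) 1)) *
                (hubbardTTPrimeFermionInteraction t t' U).localHamiltonian (thicken Λ 1)))).re -
        s * (ω''.expect (thicken Λ 1)
          ((fermionEmbed (PolySite.incl (subset_thicken Λ 1)) (creation (orb (PolySite.pt x hx) 1)))ᴴ *
            fermionEmbed (PolySite.incl (subset_thicken Λ 1)) (creation (orb (PolySite.pt x hx) 1)))).re +
        q * r₂' * (ω'.expect (thicken Λ 1)
          (fermionEmbed (PolySite.incl (subset_thicken Λ 1)) (creation (orb (PolySite.pt x hx) 1)) *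
            (fermionEmbed (PolySite.incl (subset_thicken Λ 1)) (creation (orb (PolySite.pt x hx) 1)))ᴴ)).re := by
  refine InfVolFermionState.re_expect_twoSector_eeb_nonneg_of_canonical_limits_eventually t t' U β
    (fun L => spinConfig (Λ := FermionTorus 2 L) (halfRectN n L - 1) (halfRectN n L - 1))
    (fun L => spinConfig (Λ := FermionTorus 2 L) (halfRectN n L - 1) (halfRectN n L))
    (fun L s s' hs hs' => hubbardTorusTT'_apply_eq_zero_of_spinConfig L t t' U _ _ s s' hs hs')
    (fun L s s' hs hs' => hubbardTorusTT'_apply_eq_zero_of_spinConfig L t t' U _ _ s s' hs hs')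
    (fun L _ v s s' hs hs' => fockTranslate_apply_eq_zero_of_spinConfig L v _ _ s s' hs hs')
    (fun L _ v s s' hs hs' => fockTranslate_apply_eq_zero_of_spinConfig L v _ _ s s' hs hs')
    (fun L => (Fintype.equivFin _).symm) (fun L => (Fintype.equivFin _).symm)
    (fun L i => rfl) (fun L i => rfl) (fun L i => rfl) (fun L i => rfl) hLs hω'' hω' hr₂'
    (creation (orb (PolySite.pt x hx) 1)) ?_ ?_ hq
  · filter_upwards [eventually_one_le_halfRectN_comp hn hLs] with j hk hL h₁ s s' hs hs'
    rw [fermionEmbed_toTorusEmb_incl_creation, ← annihilation_conjTranspose]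
    exact apply_eq_zero_off_of_mulVec_mem₂ (spinConfig _ _) (spinConfig _ _) (szSector _ _) (szSector _ _)
      (mem_szSector_iff_spinConfig _ _ _) (mem_szSector_iff_spinConfig _ _ _)
      (fun w hw => creation_down_mulVec_mem_szSector_pred_of_pairPred _ hk _ w hw) s s' hs hs'
  · filter_upwards [eventually_one_le_halfRectN_comp hn hLs] with j hk hL h₁ s s' hs hs'
    rw [fermionEmbed_toTorusEmb_incl_creation, creation_conjTranspose]
    exact apply_eq_zero_off_of_mulVec_mem₂ (spinConfig _ _) (spinConfig _ _) (szSector _ _) (szSector _ _)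
      (mem_szSector_iff_spinConfig _ _ _) (mem_szSector_iff_spinConfig _ _ _)
      (fun w hw => annihilation_down_mulVec_mem_szSector_pairPred _ hk _ w hw) s s' hs hs'

end Between

end Literature.MathematicalPhysics.QuantumLattice

end
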